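import Summits.ResolutionOfSingularities.KangarooAtlas.MizutaniPTowerFin
import Mathlib.RingTheory.Localization.Integer
import Mathlib.RingTheory.MvPolynomial.Basic
import HarnessLib

/-!
# Mizutani's conjecture `m(e) = 2p^e − 1` — the rational function field `F(u_1, …, u_s)` as a tower

Cell topic `Summits/ResolutionOfSingularities/KangarooAtlas` (pub-rosobs); namespace
`Summit.ResolutionOfSingularities.KangarooAtlas.Mizutani`.  Part of the Lean transcription of the
in-house note MIZUTANI-PROOF-g59 (AI-written, AI-audited; *AI review is weaker than expert review*; not a
resolution theorem).  For the ATTAINMENT half of Mizutani's conjecture (his schemes `H_e` of exponent `e` and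
dimension `2p^e − 1`, Nagoya Math. J. 52 (1973) Remark 2.10 and Example 2.1, which live over a field with
`[k : k^p] ≥ p²`) we need ONE concrete ground field with a `p`-basis of two elements.  This file provides
`k = F(u_0, …, u_{s−1})`, the field of rational functions over a field `F` of characteristic `p` all of whose
elements satisfy `c^p = c` (i.e. `F = 𝔽_p`, possibly universe-lifted):

* `RatField F s = Frac F[u]`, `ratGen F s i = u_i`;
* `pIndep_one_ratGen` — the `u_i` are `p`-INDEPENDENT: the monomials `u^W`, `W ∈ [0, p−1]^s`, are linearly
  independent over `k^p` (clear denominators, then in `F[u]` a relation `Σ_W P_W^p u^W = 0` forces `P_W = 0`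
  by reading coefficients modulo `p`);
* `adjoin_ratGen_eq_top` — `k = k^{p^e}(u)` (`g/h = g h^{q−1} · (h^q)^{-1}`);
* hence, by encloser-2's `isRootTower_adjoin` / `finrank_adjoin_eq` (`MizutaniPTowerFin`) transported along
  `k^{p^e}(u) = ⊤ ≃ k`: **`isRootTower_ratField`** — `k` is a tower `IsRootTower (k^{p^e}) k (p^e) (u^{p^e}) u`
  in the sense of `MizutaniRootTower`, with `[k : k^{p^e}] = (p^e)^s` (`finrank_ratField`) — and
  `ratGen_not_mem_frobPow` (`u_i ∉ k^p`).

References: [Mizutani1973HironakaGroupSchemes] Remark 2.10, Example 2.1 (the ground field with [k : k^p] ≥ p²);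
in-house note §1.1 (R) (the RATIONAL tower), §10.
-/

open MvPolynomial Literature.AlgebraicGeometry.Resolution.HironakaScheme

namespace Summit.ResolutionOfSingularities.KangarooAtlas.Mizutani

universe u

section RatField

variable (F : Type u) [Field F] (s : ℕ)

/-- The rational function field `F(u_0, …, u_{s−1})`. [cite: Mizutani1973HironakaGroupSchemes, Example 2.1 (a ground field with [k : k^p] ≥ p²)] -/
abbrev RatField : Type u := FractionRing (MvPolynomial (Fin s) F)

/-- The generators `u_i`. [folklore] -/
noncomputable def ratGen (i : Fin s) : RatField F s := algebraMap (MvPolynomial (Fin s) F) (RatField F s) (X i)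

variable {F s}

/-- Polynomials read in the fraction field: `P(u) = algebraMap P`. [folklore] -/
theorem aeval_ratGen (P : MvPolynomial (Fin s) F) :
    aeval (ratGen F s) P = algebraMap (MvPolynomial (Fin s) F) (RatField F s) P := by
  have : (aeval (ratGen F s) : MvPolynomial (Fin s) F →ₐ[F] RatField F s) =
      IsScalarTower.toAlgHom F (MvPolynomial (Fin s) F) (RatField F s) :=
    MvPolynomial.algHom_ext fun i => by rw [aeval_X]; rfl
  exact congrArg (fun φ => φ P) this

/-- The exponent vector of a box index `W : Fin s → Fin q`. [folklore] -/
noncomputable def finsuppOf {q : ℕ} (W : Fin s → Fin q) : Fin s →₀ ℕ :=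
  Finsupp.equivFunOnFinite.symm fun i => (W i : ℕ)

omit [Field F] in
/-- `finsuppOf W i = W i`. [folklore] -/
@[simp] theorem finsuppOf_apply {q : ℕ} (W : Fin s → Fin q) (i : Fin s) : finsuppOf W i = (W i : ℕ) := by
  simp [finsuppOf]

/-- `u^W = algebraMap (X^W)`. [folklore] -/
theorem fmon_ratGen {q : ℕ} (W : Fin s → Fin q) :
    fmon (ratGen F s) W = algebraMap (MvPolynomial (Fin s) F) (RatField F s) (monomial (finsuppOf W) 1) := by
  unfold fmon
  rw [monomial_eq, C_1, one_mul, Finsupp.prod_fintype _ _ (fun i => by simp), map_prod]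
  refine Finset.prod_congr rfl fun i _ => ?_
  rw [map_pow, finsuppOf_apply]
  rfl

/-! ### `p`-independence of the variables -/

variable {p : ℕ} [hp : Fact p.Prime] [CharP F p]

omit [CharP F p] hp in
/-- Digit uniqueness: `p • N + W = p • N' + W'` with `W, W' < p` componentwise forces `W = W'` and `N = N'`.
[folklore] -/
theorem nsmul_add_finsuppOf_inj (hp0 : 0 < p) {q : ℕ} (hq : q ≤ p) {N N' : Fin s →₀ ℕ} {W W' : Fin s → Fin q}
    (h : p • N + finsuppOf W = p • N' + finsuppOf W') : W = W' ∧ N = N' := by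
  have hc : ∀ i, p * N i + (W i : ℕ) = p * N' i + (W' i : ℕ) := fun i => by
    have := congrArg (fun M : Fin s →₀ ℕ => M i) h
    simpa using this
  have hW : W = W' := by
    funext i
    apply Fin.ext
    have h1 := congrArg (· % p) (hc i)
    simp only [Nat.mul_add_mod, Nat.mod_eq_of_lt (lt_of_lt_of_le (W i).2 hq),
      Nat.mod_eq_of_lt (lt_of_lt_of_le (W' i).2 hq)] at h1
    exact h1
  refine ⟨hW, ?_⟩
  ext i
  have h1 := hc i
  rw [hW] at h1
  have := Nat.eq_of_mul_eq_mul_left hp0 (Nat.add_right_cancel h1)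
  exact this

/-- `P^p = Σ_N coeff_N(P)^p X^{pN}` in characteristic `p`. [folklore] -/
theorem pow_char_eq_sum_monomial (P : MvPolynomial (Fin s) F) :
    P ^ p = ∑ N ∈ P.support, monomial (p • N) (coeff N P ^ p) := by
  conv_lhs => rw [P.as_sum]
  rw [sum_pow_char]
  exact Finset.sum_congr rfl fun N _ => monomial_pow

/-- Coefficient extraction: in `Σ_W P_W^p X^W` the coefficient of `X^{pN + W}` is `coeff_N(P_W)^p`. [folklore] -/
theorem coeff_sum_pow_mul_monomial {q : ℕ} (hq : q ≤ p) (P : (Fin s → Fin q) → MvPolynomial (Fin s) F)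
    (W₀ : Fin s → Fin q) (N₀ : Fin s →₀ ℕ) :
    coeff (p • N₀ + finsuppOf W₀) (∑ W, P W ^ p * monomial (finsuppOf W) 1) = coeff N₀ (P W₀) ^ p := by
  classical
  rw [coeff_sum]
  have hterm : ∀ W, coeff (p • N₀ + finsuppOf W₀) (P W ^ p * monomial (finsuppOf W) 1) =
      if W = W₀ then coeff N₀ (P W₀) ^ p else 0 := by
    intro W
    rw [pow_char_eq_sum_monomial, Finset.sum_mul, coeff_sum]
    have hNterm : ∀ N ∈ (P W).support,
        coeff (p • N₀ + finsuppOf W₀) (monomial (p • N) (coeff N (P W) ^ p) * monomial (finsuppOf W) 1) =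
          if W = W₀ ∧ N = N₀ then coeff N₀ (P W₀) ^ p else 0 := by
      intro N _
      rw [monomial_mul, mul_one, coeff_monomial]
      by_cases h : p • N + finsuppOf W = p • N₀ + finsuppOf W₀
      · obtain ⟨hW, hN⟩ := nsmul_add_finsuppOf_inj hp.out.pos hq h
        subst hW; subst hN
        rw [if_pos rfl, if_pos ⟨rfl, rfl⟩]
      · rw [if_neg h, if_neg]
        rintro ⟨rfl, rfl⟩; exact h rfl
    rw [Finset.sum_congr rfl hNterm]
    by_cases hW : W = W₀
    · subst hW
      simp only [true_and]
      rw [Finset.sum_ite_eq' (P W).support N₀]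
      split_ifs with hmem
      · rfl
      · rw [notMem_support_iff.mp hmem, zero_pow hp.out.ne_zero]
    · simp [hW]
  rw [Finset.sum_congr rfl fun W _ => hterm W, Finset.sum_ite_eq' Finset.univ W₀, if_pos (Finset.mem_univ _)]

/-- In `F[u]`: `Σ_W P_W^p u^W = 0` (`W` over the box `[0,p−1]^s`) forces every `P_W = 0`. [cite: Mizutani1973HironakaGroupSchemes, Lemma 2.4 (p. 88: p-independence)] -/
theorem eq_zero_of_sum_pow_mul_monomial_eq_zero {q : ℕ} (hq : q ≤ p) (P : (Fin s → Fin q) → MvPolynomial (Fin s) F)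
    (h : ∑ W, P W ^ p * monomial (finsuppOf W) 1 = 0) (W : Fin s → Fin q) : P W = 0 := by
  refine MvPolynomial.ext _ _ fun N => ?_
  have := coeff_sum_pow_mul_monomial hq P W N
  rw [h, coeff_zero] at this
  rw [coeff_zero]
  exact (pow_eq_zero_iff hp.out.ne_zero).mp this.symm

/-- The rational function field has characteristic `p`. [folklore] -/
instance charP_ratField : CharP (RatField F s) p :=
  charP_of_injective_algebraMap (IsFractionRing.injective (MvPolynomial (Fin s) F) (RatField F s)) p

/-- **The variables `u_i` are `p`-independent**: the monomials `u^W`, `W ∈ [0, p−1]^s`, are linearly independent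
over `k^p`, `k = F(u)`. [cite: Mizutani1973HironakaGroupSchemes, Lemma 2.4 (p. 88) and Example 2.1] -/
theorem pIndep_one_ratGen : PIndep p 1 (ratGen F s) := by
  classical
  set A := MvPolynomial (Fin s) F with hA
  set K := RatField F s with hK
  unfold PIndep
  refine Fintype.linearIndependent_iff.mpr fun g hg => ?_
  -- `p`-th roots of the coefficients
  have hroot : ∀ W, ∃ z : K, z ^ p = ((g W : frobPow K p 1) : K) := fun W => by
    have := mem_frobPow_iff.mp (g W).2
    simpa only [pow_one] using this
  choose z hz using hroot
  -- a common denominator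
  obtain ⟨D, hD⟩ := IsLocalization.exist_integer_multiples (nonZeroDivisors A) Finset.univ z
  have hint : ∀ W, ∃ P : A, algebraMap A K P = (D : A) • z W := fun W =>
    (hD W (Finset.mem_univ W)).imp fun P hP => hP
  choose P hP using hint
  have hD0 : algebraMap A K D ≠ 0 := IsFractionRing.to_map_ne_zero_of_mem_nonZeroDivisors D.2
  -- the polynomial relation `Σ_W P_W^p X^W = 0`
  have hrel : ∑ W : Fin s → Fin (p ^ 1), P W ^ p * monomial (finsuppOf W) 1 = 0 := by
    apply IsFractionRing.injective A K
    rw [map_sum, map_zero]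
    have : ∀ W : Fin s → Fin (p ^ 1), algebraMap A K (P W ^ p * monomial (finsuppOf W) 1) =
        algebraMap A K D ^ p * (((g W : frobPow K p 1) : K) * fmon (ratGen F s) W) := by
      intro W
      rw [map_mul, map_pow, hP W, Algebra.smul_def, mul_pow, hz W, ← fmon_ratGen, mul_assoc]
    rw [Finset.sum_congr rfl fun W _ => this W, ← Finset.mul_sum]
    have hg' : ∑ W : Fin s → Fin (p ^ 1), ((g W : frobPow K p 1) : K) * fmon (ratGen F s) W = 0 := by
      rw [← hg]
      exact Finset.sum_congr rfl fun W _ => by rw [Subfield.smul_def, smul_eq_mul]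
    rw [hg', mul_zero]
  -- read off `P_W = 0`, hence `g W = 0`
  intro W
  have hPW : P W = 0 := eq_zero_of_sum_pow_mul_monomial_eq_zero (le_of_eq (pow_one p)) P hrel W
  have hzW : z W = 0 := by
    have h1 := hP W
    rw [hPW, map_zero, Algebra.smul_def] at h1
    exact (mul_eq_zero.mp h1.symm).resolve_left hD0
  apply Subtype.ext
  rw [← hz W, hzW, zero_pow hp.out.ne_zero]
  rfl

/-- `u_i ∉ k^p` (`1` and `u_i` are `k^p`-independent). [cite: Mizutani1973HironakaGroupSchemes, Example 2.1 (x, y p-independent)] -/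
theorem ratGen_not_mem_frobPow (i : Fin s) : ratGen F s i ∉ frobPow (RatField F s) p 1 := by
  classical
  intro hmem
  have hli := pIndep_one_ratGen (F := F) (s := s) (p := p)
  have hp1 : 1 < p ^ 1 := by rw [pow_one]; exact hp.out.one_lt
  set W₀ : Fin s → Fin (p ^ 1) := fun _ => ⟨0, by omega⟩ with hW₀
  set W₁ : Fin s → Fin (p ^ 1) := Function.update W₀ i ⟨1, hp1⟩ with hW₁
  have hne : W₁ ≠ W₀ := by
    intro h
    have := congrArg (fun W => (W i : ℕ)) h
    simp [hW₁, hW₀] at this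
  have h0 : fmon (ratGen F s) W₀ = 1 := by
    unfold fmon; exact Finset.prod_eq_one fun j _ => by simp [hW₀]
  have h1 : fmon (ratGen F s) W₁ = ratGen F s i := by
    unfold fmon
    rw [Finset.prod_eq_single i]
    · simp [hW₁]
    · intro j _ hj; simp [hW₁, Function.update_of_ne hj, hW₀]
    · intro h; exact absurd (Finset.mem_univ i) h
  -- the relation `u_i · u^{W₀} − 1 · u^{W₁} = 0` with coefficients in `k^p`
  have key := (linearIndependent_iff'.mp hli) {W₀, W₁}
    (fun W => if W = W₀ then ⟨ratGen F s i, hmem⟩ else -1) ?_ W₀ (Finset.mem_insert_self _ _)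
  · rw [if_pos rfl] at key
    have h2 := congrArg Subtype.val key
    exact (IsFractionRing.injective (MvPolynomial (Fin s) F) (RatField F s)).ne (X_ne_zero i)
      (by rw [map_zero]; exact h2)
  · rw [Finset.sum_pair hne.symm, if_pos rfl, if_neg hne, h0, h1, Subfield.smul_def, Subfield.smul_def,
      smul_eq_mul, smul_eq_mul, mul_one]
    simp

/-! ### `k = k^{p^e}(u)` and the tower structure -/

omit hp [CharP F p] in
/-- In `𝔽_p`-like coefficient fields every constant is a `p^e`-th power of itself. [folklore] -/
theorem pow_char_pow_eq_self (hF : ∀ c : F, c ^ p = c) (e : ℕ) (c : F) : c ^ p ^ e = c := by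
  induction e with
  | zero => rw [pow_zero, pow_one]
  | succ e ih => rw [pow_succ, pow_mul, ih, hF]

/-- Polynomials lie in `k^{p^e}(u)`. [folklore] -/
theorem algebraMap_mem_adjoin (hF : ∀ c : F, c ^ p = c) (e : ℕ) (P : MvPolynomial (Fin s) F) :
    algebraMap (MvPolynomial (Fin s) F) (RatField F s) P ∈
      IntermediateField.adjoin (frobPow (RatField F s) p e) (Set.range (ratGen F s)) := by
  induction P using MvPolynomial.induction_on with
  | C c =>
    have hc : algebraMap (MvPolynomial (Fin s) F) (RatField F s) (C c) ∈ frobPow (RatField F s) p e := by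
      rw [mem_frobPow_iff]
      exact ⟨algebraMap _ _ (C c), by rw [← map_pow, ← C_pow, pow_char_pow_eq_self hF]⟩
    exact IntermediateField.algebraMap_mem
      (IntermediateField.adjoin (frobPow (RatField F s) p e) (Set.range (ratGen F s)))
      (⟨_, hc⟩ : frobPow (RatField F s) p e)
  | add P Q hP hQ => rw [map_add]; exact add_mem hP hQ
  | mul_X P i hP =>
    rw [map_mul]
    exact mul_mem hP (IntermediateField.subset_adjoin _ _ ⟨i, rfl⟩)

/-- **`k = k^{p^e}(u_0, …, u_{s−1})`** for `k = F(u)`: `g/h = (g h^{q−1}) · (h^q)^{−1}` with `h^q ∈ k^q`.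
[cite: Mizutani1973HironakaGroupSchemes, Example 2.1 (k generated over k^p by a p-basis)] -/
theorem adjoin_ratGen_eq_top (hF : ∀ c : F, c ^ p = c) (e : ℕ) :
    IntermediateField.adjoin (frobPow (RatField F s) p e) (Set.range (ratGen F s)) = ⊤ := by
  rw [eq_top_iff]
  intro z _
  obtain ⟨g, h, -, rfl⟩ := IsFractionRing.div_surjective (A := MvPolynomial (Fin s) F) z
  exact div_mem (algebraMap_mem_adjoin hF e g) (algebraMap_mem_adjoin hF e h)

/-! ### Transport of towers along isomorphisms -/

omit hp [CharP F p] in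
/-- A tower structure transports along an `L`-algebra isomorphism of the top field. [folklore] -/
theorem IsRootTower.of_algEquiv {L K K' : Type*} [Field L] [Field K] [Field K'] [Algebra L K] [Algebra L K']
    {t : ℕ} {q : ℕ} {x : Fin t → L} {a : Fin t → K} (h : IsRootTower L K q x a) (φ : K ≃ₐ[L] K') :
    IsRootTower L K' q x (φ ∘ a) := by
  have hpow : ∀ i, (φ ∘ a) i ^ q = algebraMap L K' (x i) := fun i => by
    rw [Function.comp_apply, ← map_pow, h.pow_eq, AlgEquiv.commutes]
  refine ⟨hpow, ?_⟩
  have heq : liftHom (φ ∘ a) hpow = (φ : K →ₐ[L] K').comp (liftHom a h.pow_eq) :=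
    algHom_ext_rootGen fun i => by
      rw [liftHom_rootGen, AlgHom.comp_apply, liftHom_rootGen]; rfl
  rw [heq]
  exact φ.bijective.comp h.bijective

/-- **`k = F(u)` is a tower over `k^{p^e}`**: `IsRootTower (k^{p^e}) k (p^e) (u^{p^e}) u` (`e ≥ 1`), from
encloser-2's `isRootTower_adjoin` for the `p`-independent family `u` and `k^{p^e}(u) = k`.
[cite: Mizutani1973HironakaGroupSchemes, Example 2.1 (in-house note §1.1 (R): the rational tower)] -/
theorem isRootTower_ratField (hF : ∀ c : F, c ^ p = c) {e : ℕ} (he : 1 ≤ e) :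
    IsRootTower (frobPow (RatField F s) p e) (RatField F s) (p ^ e) (towerPow e (ratGen F s)) (ratGen F s) := by
  have hb : PIndep p e (ratGen F s) := PIndep.of_one pIndep_one_ratGen e he
  have h := isRootTower_adjoin hb
  set φ : towerField e (ratGen F s) ≃ₐ[frobPow (RatField F s) p e] RatField F s :=
    (IntermediateField.equivOfEq (adjoin_ratGen_eq_top hF e)).trans IntermediateField.topEquiv with hφ
  have hcomp : (φ ∘ towerGen e (ratGen F s)) = ratGen F s := by
    funext i
    rw [Function.comp_apply, hφ, AlgEquiv.trans_apply, IntermediateField.topEquiv_apply,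
      IntermediateField.equivOfEq_apply, coe_towerGen]
  rw [← hcomp]
  exact h.of_algEquiv φ

/-- **`[k : k^{p^e}] = (p^e)^s`** for `k = F(u_0, …, u_{s−1})` (`e ≥ 1`).
[cite: Mizutani1973HironakaGroupSchemes, Example 2.1 (in-house note §1.1)] -/
theorem finrank_ratField (hF : ∀ c : F, c ^ p = c) {e : ℕ} (he : 1 ≤ e) :
    Module.finrank (frobPow (RatField F s) p e) (RatField F s) = (p ^ e) ^ s := by
  have hb : PIndep p e (ratGen F s) := PIndep.of_one pIndep_one_ratGen e he
  set φ : towerField e (ratGen F s) ≃ₐ[frobPow (RatField F s) p e] RatField F s :=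
    (IntermediateField.equivOfEq (adjoin_ratGen_eq_top hF e)).trans IntermediateField.topEquiv with hφ
  rw [← φ.toLinearEquiv.finrank_eq, finrank_adjoin_eq hb]

end RatField

end Summit.ResolutionOfSingularities.KangarooAtlas.Mizutani
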